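import Literature.Geometry.GeometricMeasureTheory.CubicalModel
import Literature.Geometry.GeometricMeasureTheory.CurrentsLipschitzPushforward
import Literature.Geometry.GeometricMeasureTheory.CurrentsSlicingLipschitz
import HarnessLib

/-!
# The admissible push-forward `f_{#u} T` (Federer 4.2.2), part I

Support file for the proof of the named fact
`Literature.Geometry.GeometricMeasureTheory.Federer1969_compactness_integralCurrents`
(Federer–Fleming compactness, [Federer1969, 4.2.17 (2)]), on the way to the deformation theorem
4.2.9. Federer 4.2.2: for a normal current `T`, a nonnegative function `u` with `Lip(u) ≤ 1`,
`A = {u > 0}`, and a locally Lipschitz `f` on `A` with `‖Df(x)‖ ≤ 1/u(x)` ("`u`-admissible"),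
the push-forward `f_{#u} T = lim_{r → 0+} f_#(T ⌞ {u > r})` exists when `‖T‖(u^{-m}) < ∞`, with
`𝐌(f_{#u} T) ≤ ‖T‖(u^{-m})`. In the deformation theorem `f = σ_i ∘ τ_a` (the cubical retractions
of `CubicalModel.lean`) and `u = u_m ∘ τ_a`.

This file carries out the construction in the Lipschitz framework of
`CurrentsLipschitzPushforward.lean` (push-forwards of normal currents with compact support along
globally Lipschitz maps), in a finite-dimensional inner product space `V` (an orthonormal basis `b`
is used only to extend Lipschitz maps through coordinates):

* `Current.lipPushforward_congr` — `f_# T` depends only on `f` near `spt T`;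
  `Current.lipPushforward_add'`, `Current.lipPushforward_neg'` — additivity in `T`;
* `Admissible v g C` — the metric admissibility condition (from base points with `v ≥ r`, `g` is
  `C/r`-Lipschitz; `CubicalModel.dist_sigmaV_le_of_le_uV`); `Admissible.ext` — global Lipschitz
  extensions `G_r` of `g | {v ≥ r/2}` (`LipschitzOnWith.exists_extension_inner`, constant
  `extConst n C r = √n · 2C/r`);
* `Current.restrictAbove S hS hv r = S ⌞ {v > r}`, `Current.restrictShell`, the shell
  decomposition, and `Current.admPush … hr hgood = (G_r)_# (S ⌞ {v > r})` for **good radii**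
  (`∂(S ⌞ {v > r})` of finite mass — almost every `r`, `CurrentsSlicingLipschitz.lean`);
  **the shell identity** `admPush_sub_admPush : P_{r'} − P_r = (G_{r'})_# (S ⌞ {r' < v ≤ r})` and
  the estimates `𝐌 ≤ (8C√n)^{d+1} ∫_{shell} (1/v)^{d+1} d‖S‖` (`mass_admPushShell_le_lintegral`);
* `Current.GoodSeq` / `Current.exists_goodSeq` — dyadic good sequences `r_j ∈ (ε2^{-j-1}, ε2^{-j}]`;
* `Current.ShellFamily` — the abstract passage to the limit (telescoping series of masses bounded
  by `K ∫ w d‖S‖` over disjoint shells; `Current.weakLim`, `Current.ofSupNormBound`): the limit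
  `ShellFamily.lim` exists when `∫ w d‖S‖ < ∞`, `𝐌(lim) ≤ K ∫ w d‖S‖` (`mass_lim_le`), and it is
  **independent of the good sequence** (`lim_eq`);
* `Current.admPushLim` — **`g_{#v} S`**, with `mass_admPushLim_le`
  (`𝐌(g_{#v} S) ≤ (8C√n)^{d+1} ∫ (1/v)^{d+1} d‖S‖`), `admPushLim_eq` (independence) and
  `support_admPushLim_subset` (`spt g_{#v} S ⊆ Z` whenever `g` maps `{v > 0}` into the closed `Z`).

Boundary behaviour, homotopies and the homotopy formula of 4.2.2 follow in a sequel.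

## References

* H. Federer, *Geometric Measure Theory*, Springer 1969, 4.2.1–4.2.2 (held copy
  `lit book:federernd-geometric-measure-theory`, PDF pp. 334–337) [Federer1969].
-/

noncomputable section

open scoped Distributions ENNReal NNReal Topology ContDiff InnerProductSpace
open MeasureTheory TopologicalSpace Set Filter Metric Function Module

namespace Literature.Geometry.GeometricMeasureTheory

-- Nested operator-norm instances on (duals of) `E [⋀^Fin m]→L[ℝ] ℝ`.
set_option maxSynthPendingDepth 2

/-! ### Congruence and additivity of the Lipschitz push-forward -/

section LipCongr

variable {E E' : Type*} [NormedAddCommGroup E] [NormedSpace ℝ E] [FiniteDimensional ℝ E]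
  [NormedAddCommGroup E'] [NormedSpace ℝ E'] [FiniteDimensional ℝ E']
  {Ω : Opens E} {Ω' : Opens E'} {m : ℕ}

/-- A cutoff in `𝒟⁰(Ω)` equal to `1` near a compact `K ⊆ Ω ∩ N` and supported in the open set
`N`. [folklore] -/
theorem exists_testFunction_eq_one_nhds_subset {K N : Set E} (hK : IsCompact K) (hN : IsOpen N)
    (hKΩ : K ⊆ (Ω : Set E)) (hKN : K ⊆ N) :
    ∃ (χ : 𝓓(Ω, ℝ)) (U : Set E), IsOpen U ∧ K ⊆ U ∧ (∀ x ∈ U, χ x = 1) ∧ (∀ x, |χ x| ≤ 1) ∧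
      tsupport ⇑χ ⊆ N := by
  obtain ⟨χ', U, hU, hKU, h1, h01⟩ := exists_testFunction_eq_one_nhds
    (Ω := ⟨(Ω : Set E) ∩ N, Ω.isOpen.inter hN⟩) hK (subset_inter hKΩ hKN)
  refine ⟨⟨χ', χ'.contDiff, χ'.hasCompactSupport, (χ'.tsupport_subset).trans inter_subset_left⟩,
    U, hU, hKU, h1, fun x => ?_, (χ'.tsupport_subset).trans inter_subset_right⟩
  have := h01 x
  show |χ' x| ≤ 1
  rw [abs_le]; constructor <;> linarith [this.1, this.2]

namespace Current

variable (T : Current Ω (m + 1)) (hT : T.mass ≠ ⊤) (hdT : T.boundary.mass ≠ ⊤)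
  (hsupp : IsCompact T.support)

/-- The approximating push-forwards computed with any other admissible cutoff. [folklore] -/
theorem lipPushSeq_eq_pushforward {f : E → E'} {L : ℝ≥0} (hf : LipschitzWith L f)
    {χ : 𝓓(Ω, ℝ)} {U : Set E} (hU : IsOpen U) (hTU : T.support ⊆ U) (hχ : ∀ x ∈ U, χ x = 1)
    (n : ℕ) : T.lipPushSeq hsupp hf Ω' n = T.pushforward Ω' χ (contDiff_lipApprox hf n) := by
  obtain ⟨hUo, hTU', hχ1, -⟩ := T.cutoff_spec hsupp
  exact T.pushforward_congr_cutoff (contDiff_lipApprox hf n) (hUo.inter hU)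
    (subset_inter hTU' hTU) fun x hx => by rw [hχ1 x hx.1, hχ x hx.2]

include hT hdT in
/-- **The Lipschitz push-forward depends only on `f` near `spt T`**: two Lipschitz maps that agree
on an open neighbourhood of `spt T` give the same `f_# T`. [cite: Federer1969, 4.1.14, 4.1.15] -/
theorem lipPushforward_congr {f₁ f₂ : E → E'} {L₁ L₂ : ℝ≥0} (hf₁ : LipschitzWith L₁ f₁)
    (hf₂ : LipschitzWith L₂ f₂) {N : Set E} (hN : IsOpen N) (hTN : T.support ⊆ N)
    (heq : Set.EqOn f₁ f₂ N) :
    T.lipPushforward hT hdT hsupp hf₁ Ω' = T.lipPushforward hT hdT hsupp hf₂ Ω' := by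
  ext φ
  obtain ⟨χ, U, hU, hTU, hχ1, hχabs, hχN⟩ :=
    exists_testFunction_eq_one_nhds_subset hsupp hN T.support_subset hTN
  obtain ⟨hVo, h01, hρ1, hρabs, hρ2⟩ := timeCutoff_spec
  obtain ⟨Cφ, hCφ, hφ⟩ := φ.exists_norm_le
  obtain ⟨Cd, hCd, hdφ⟩ := φ.exists_norm_extDeriv_le
  set L : ℝ := max (L₁ : ℝ) L₂ with hLdef
  have hL : 0 ≤ L := le_max_of_le_left L₁.coe_nonneg
  set K := (5 * L) ^ (m + 1) * T.mass.toReal * Cd + (5 * L) ^ m * T.boundary.mass.toReal * Cφ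
  have hn : ∀ n : ℕ, |T.lipPushSeq hsupp hf₂ Ω' n φ - T.lipPushSeq hsupp hf₁ Ω' n φ| ≤
      (2 / ((n : ℝ) + 1)) * K := by
    intro n
    rw [T.lipPushSeq_eq_pushforward hsupp hf₁ hU hTU hχ1 n,
      T.lipPushSeq_eq_pushforward hsupp hf₂ hU hTU hχ1 n]
    refine T.abs_pushforward_sub_apply_le hT hdT χ timeCutoff hU hTU hχ1 hχabs hVo h01 hρ1 hρabs
      hρ2 (contDiff_lipApprox hf₁ n) (contDiff_lipApprox hf₂ n) hL (by positivity)
      (fun x _ => (norm_fderiv_lipApprox_le hf₁ n x).trans (le_max_left _ _))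
      (fun x _ => (norm_fderiv_lipApprox_le hf₂ n x).trans (le_max_right _ _)) (fun x hx => ?_)
      φ hCφ hCd hφ hdφ
    have hx' : f₁ x = f₂ x := heq (hχN hx)
    calc ‖lipApprox hf₂ n x - lipApprox hf₁ n x‖
        ≤ ‖lipApprox hf₂ n x - f₂ x‖ + ‖f₂ x - lipApprox hf₁ n x‖ := norm_sub_le_norm_sub_add_norm_sub _ _ _
      _ ≤ 1 / ((n : ℝ) + 1) + 1 / ((n : ℝ) + 1) := by
          refine add_le_add ?_ ?_
          · rw [← dist_eq_norm]; exact dist_lipApprox_le hf₂ n x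
          · rw [← hx', ← dist_eq_norm, dist_comm]; exact dist_lipApprox_le hf₁ n x
      _ = 2 / ((n : ℝ) + 1) := by ring
  have hlim0 : Tendsto (fun n : ℕ => (2 / ((n : ℝ) + 1)) * K) atTop (𝓝 (0 * K)) := by
    refine Tendsto.mul_const K ?_
    have := (tendsto_const_div_atTop_nhds_zero_nat (2 : ℝ)).comp (tendsto_add_atTop_nat 1)
    refine this.congr fun n => ?_
    simp [Function.comp]
  rw [zero_mul] at hlim0
  have hdiff : Tendsto (fun n => T.lipPushSeq hsupp hf₂ Ω' n φ - T.lipPushSeq hsupp hf₁ Ω' n φ) atTop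
      (𝓝 (T.lipPushforward hT hdT hsupp hf₂ Ω' φ - T.lipPushforward hT hdT hsupp hf₁ Ω' φ)) :=
    (T.tendsto_lipPushSeq hT hdT hsupp hf₂ φ).sub (T.tendsto_lipPushSeq hT hdT hsupp hf₁ φ)
  have h0 : Tendsto (fun n => T.lipPushSeq hsupp hf₂ Ω' n φ - T.lipPushSeq hsupp hf₁ Ω' n φ) atTop
      (𝓝 0) := squeeze_zero_norm (fun n => by rw [Real.norm_eq_abs]; exact hn n) hlim0
  have := tendsto_nhds_unique hdiff h0
  linarith

end Current

/-- **Additivity in the current** of the Lipschitz push-forward: `f_#(T₁ + T₂) = f_# T₁ + f_# T₂`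
(all three computed with a common cutoff `= 1` near `spt T₁ ∪ spt T₂`). [cite: Federer1969, 4.1.14] -/
theorem Current.lipPushforward_add' {T₁ T₂ : Current Ω (m + 1)}
    (h₁ : T₁.mass ≠ ⊤) (hd₁ : T₁.boundary.mass ≠ ⊤) (hs₁ : IsCompact T₁.support)
    (h₂ : T₂.mass ≠ ⊤) (hd₂ : T₂.boundary.mass ≠ ⊤) (hs₂ : IsCompact T₂.support)
    (h₁₂ : (T₁ + T₂).mass ≠ ⊤) (hd₁₂ : (T₁ + T₂).boundary.mass ≠ ⊤)
    (hs₁₂ : IsCompact (T₁ + T₂).support) {f : E → E'} {L : ℝ≥0} (hf : LipschitzWith L f) :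
    (T₁ + T₂).lipPushforward h₁₂ hd₁₂ hs₁₂ hf Ω' =
      T₁.lipPushforward h₁ hd₁ hs₁ hf Ω' + T₂.lipPushforward h₂ hd₂ hs₂ hf Ω' := by
  ext φ
  obtain ⟨χ, U, hU, hKU, hχ1, -⟩ := exists_testFunction_eq_one_nhds (Ω := Ω) (hs₁.union hs₂)
    (union_subset T₁.support_subset T₂.support_subset)
  have hsub : (T₁ + T₂).support ⊆ U := (Current.support_add_subset T₁ T₂).trans hKU
  have hn : ∀ n : ℕ, (T₁ + T₂).lipPushSeq hs₁₂ hf Ω' n φ =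
      T₁.lipPushSeq hs₁ hf Ω' n φ + T₂.lipPushSeq hs₂ hf Ω' n φ := fun n => by
    rw [(T₁ + T₂).lipPushSeq_eq_pushforward hs₁₂ hf hU hsub hχ1 n,
      T₁.lipPushSeq_eq_pushforward hs₁ hf hU (subset_union_left.trans hKU) hχ1 n,
      T₂.lipPushSeq_eq_pushforward hs₂ hf hU (subset_union_right.trans hKU) hχ1 n,
      Current.pushforward_add]
    rfl
  have hlim := ((T₁.tendsto_lipPushSeq h₁ hd₁ hs₁ hf φ).add (T₂.tendsto_lipPushSeq h₂ hd₂ hs₂ hf φ))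
  exact tendsto_nhds_unique (((T₁ + T₂).tendsto_lipPushSeq h₁₂ hd₁₂ hs₁₂ hf φ).congr hn) hlim

/-- **`f_#(-T) = -f_# T`.** [cite: Federer1969, 4.1.14] -/
theorem Current.lipPushforward_neg' {T : Current Ω (m + 1)}
    (h : T.mass ≠ ⊤) (hd : T.boundary.mass ≠ ⊤) (hs : IsCompact T.support)
    (h' : (-T).mass ≠ ⊤) (hd' : (-T).boundary.mass ≠ ⊤) (hs' : IsCompact (-T).support)
    {f : E → E'} {L : ℝ≥0} (hf : LipschitzWith L f) :
    (-T).lipPushforward h' hd' hs' hf Ω' = -T.lipPushforward h hd hs hf Ω' := by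
  ext φ
  obtain ⟨hUo, hTU, hχ1, -⟩ := T.cutoff_spec hs
  have hn : ∀ n : ℕ, (-T).lipPushSeq hs' hf Ω' n φ = -T.lipPushSeq hs hf Ω' n φ := fun n => by
    rw [(-T).lipPushSeq_eq_pushforward hs' hf hUo (by rw [Current.support_neg]; exact hTU) hχ1 n,
      Current.lipPushSeq, Current.pushforward_neg]
    rfl
  exact tendsto_nhds_unique (((-T).tendsto_lipPushSeq h' hd' hs' hf φ).congr hn)
    ((T.tendsto_lipPushSeq h hd hs hf φ).neg)

end LipCongr


/-! ## The admissible push-forward (Federer 4.2.2) — Part A: extensions, good radii, shells -/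

section AdmissibleA

open Cubical

variable {V : Type*} [NormedAddCommGroup V] [InnerProductSpace ℝ V] [FiniteDimensional ℝ V]
  [MeasurableSpace V] [BorelSpace V] {n d : ℕ}

omit [FiniteDimensional ℝ V] [MeasurableSpace V] [BorelSpace V] in
/-- **Lipschitz extension of `V`-valued maps through coordinates** (McShane coordinatewise in an
orthonormal basis, `LipschitzOnWith.extend_pi`): a `K`-Lipschitz map on a subset extends to a
`√n K`-Lipschitz map on the whole space. [folklore] -/
theorem LipschitzOnWith.exists_extension_inner (b : OrthonormalBasis (Fin n) ℝ V) {α : Type*}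
    [PseudoMetricSpace α] {g : α → V} {A : Set α} {K : ℝ≥0} (hg : LipschitzOnWith K g A) :
    ∃ G : α → V, LipschitzWith (NNReal.sqrt n * K) G ∧ Set.EqOn G g A := by
  have h1 : LipschitzOnWith K (fun x => coord b (g x)) A :=
    LipschitzOnWith.of_dist_le_mul fun x hx y hy =>
      (dist_coord_le b _ _).trans (hg.dist_le_mul x hx y hy)
  obtain ⟨G₀, hG₀, heq⟩ := h1.extend_pi
  refine ⟨fun x => uncoord b (G₀ x), LipschitzWith.of_dist_le_mul fun x y => ?_, fun x hx => ?_⟩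
  · calc dist (uncoord b (G₀ x)) (uncoord b (G₀ y)) ≤ Real.sqrt n * dist (G₀ x) (G₀ y) :=
          dist_uncoord_le b _ _
      _ ≤ Real.sqrt n * (K * dist x y) :=
          mul_le_mul_of_nonneg_left (hG₀.dist_le_mul x y) (Real.sqrt_nonneg _)
      _ = (NNReal.sqrt n * K : ℝ≥0) * dist x y := by
          rw [NNReal.coe_mul, Real.coe_sqrt]; push_cast; ring
  · show uncoord b (G₀ x) = g x
    rw [← heq hx]
    exact uncoord_coord b (g x)

/-- **The support of a restriction lies in the closure of the set.** [cite: Federer1969, 4.1.7] -/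
theorem Current.IsRepresentable.support_restrictSet_subset_closure {Ω : Opens V} {m : ℕ}
    {T : Current Ω m} (hT : T.IsRepresentable) {A : Set V} (hA : MeasurableSet A) :
    (hT.restrictSet A hA).support ⊆ closure A := by
  intro x hx
  by_contra hxA
  have hW : (closure A)ᶜ ∈ 𝓝 x := isClosed_closure.isOpen_compl.mem_nhds hxA
  obtain ⟨φ, hφ, hne⟩ := hx.2 _ hW
  refine hne (hT.restrictSet_apply_of_disjoint hA ?_)
  exact Set.disjoint_left.2 fun y hy hyA => (hφ (subset_tsupport _ hy)) (subset_closure hyA)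

/-! ### The admissible system and its extensions -/

/-- **Admissibility** of a map `g` relative to a control function `v` with constant `C`
("`‖D f(x)‖ ≤ 1/u(x)`" in metric form): from every base point `x` with `v x ≥ r > 0`, `g` is
`(C/r)`-Lipschitz. [cite: Federer1969, 4.2.2] -/
def Admissible (v : V → ℝ) (g : V → V) (C : ℝ) : Prop :=
  ∀ ⦃r : ℝ⦄, 0 < r → ∀ ⦃x : V⦄, r ≤ v x → ∀ y : V, dist (g x) (g y) ≤ C / r * dist x y

variable {v : V → ℝ} {g : V → V} {C : ℝ}

omit [InnerProductSpace ℝ V] [FiniteDimensional ℝ V] [MeasurableSpace V] [BorelSpace V] in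
/-- An admissible map is Lipschitz on `{v ≥ r}`. [cite: Federer1969, 4.2.2] -/
theorem Admissible.lipschitzOnWith [NormedSpace ℝ V] (h : Admissible v g C) (hC : 0 ≤ C) {r : ℝ}
    (hr : 0 < r) : LipschitzOnWith (Real.toNNReal (C / r)) g {x | r ≤ v x} :=
  LipschitzOnWith.of_dist_le_mul fun x hx y _ => by
    rw [Real.coe_toNNReal _ (div_nonneg hC hr.le)]; exact h hr hx y

/-- The global Lipschitz constant of the extension from `{v ≥ r/2}`: `√n · 2C/r`. [folklore] -/
def extConst (n : ℕ) (C r : ℝ) : ℝ≥0 := NNReal.sqrt n * Real.toNNReal (C / (r / 2))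

omit [FiniteDimensional ℝ V] [MeasurableSpace V] [BorelSpace V] in
/-- **The extensions `G_r`**: a globally Lipschitz map agreeing with `g` on `{v ≥ r/2}`.
[cite: Federer1969, 4.2.2] -/
theorem Admissible.exists_ext (b : OrthonormalBasis (Fin n) ℝ V) (h : Admissible v g C) (hC : 0 ≤ C)
    {r : ℝ} (hr : 0 < r) :
    ∃ G : V → V, LipschitzWith (extConst n C r) G ∧ Set.EqOn G g {x | r / 2 ≤ v x} :=
  LipschitzOnWith.exists_extension_inner b (h.lipschitzOnWith hC (half_pos hr))

/-- A chosen extension `G_r`. [cite: Federer1969, 4.2.2] -/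
def Admissible.ext (b : OrthonormalBasis (Fin n) ℝ V) (h : Admissible v g C) (hC : 0 ≤ C) {r : ℝ}
    (hr : 0 < r) : V → V :=
  Classical.choose (h.exists_ext b hC hr)

omit [FiniteDimensional ℝ V] [MeasurableSpace V] [BorelSpace V] in
/-- `G_r` is globally Lipschitz. [cite: Federer1969, 4.2.2] -/
theorem Admissible.lipschitzWith_ext (b : OrthonormalBasis (Fin n) ℝ V) (h : Admissible v g C)
    (hC : 0 ≤ C) {r : ℝ} (hr : 0 < r) : LipschitzWith (extConst n C r) (h.ext b hC hr) :=
  (Classical.choose_spec (h.exists_ext b hC hr)).1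

omit [FiniteDimensional ℝ V] [MeasurableSpace V] [BorelSpace V] in
/-- `G_r = g` on `{v ≥ r/2}`. [cite: Federer1969, 4.2.2] -/
theorem Admissible.ext_eqOn (b : OrthonormalBasis (Fin n) ℝ V) (h : Admissible v g C) (hC : 0 ≤ C)
    {r : ℝ} (hr : 0 < r) : Set.EqOn (h.ext b hC hr) g {x | r / 2 ≤ v x} :=
  (Classical.choose_spec (h.exists_ext b hC hr)).2

omit [FiniteDimensional ℝ V] [MeasurableSpace V] [BorelSpace V] in
/-- Two extensions agree on `{v > r/2}` for `r' ≤ r`. [folklore] -/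
theorem Admissible.ext_eqOn_ext (b : OrthonormalBasis (Fin n) ℝ V) (h : Admissible v g C)
    (hC : 0 ≤ C) {r r' : ℝ} (hr : 0 < r) (hr' : 0 < r') (hle : r' ≤ r) :
    Set.EqOn (h.ext b hC hr) (h.ext b hC hr') {x | r / 2 < v x} := fun x hx => by
  have hx' : r / 2 < v x := hx
  exact (h.ext_eqOn b hC hr hx'.le).trans (h.ext_eqOn b hC hr' (show r' / 2 ≤ v x by linarith)).symm

/-! ### Restricted currents -/

omit [InnerProductSpace ℝ V] [FiniteDimensional ℝ V] in
/-- The shell `{r' < v ≤ r}` is measurable. [folklore] -/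
theorem measurableSet_shell [NormedSpace ℝ V] (hv : Continuous v) (r' r : ℝ) : MeasurableSet {x : V | r' < v x ∧ v x ≤ r} :=
  (measurableSet_lt_of_continuous hv r').inter (isClosed_le hv continuous_const).measurableSet

/-- `S ⌞ {v > r}`. [cite: Federer1969, 4.2.2] -/
def Current.restrictAbove (S : Current (⊤ : Opens V) (d + 1)) (hS : S.mass ≠ ⊤) (hv : Continuous v)
    (r : ℝ) : Current (⊤ : Opens V) (d + 1) :=
  (S.isRepresentable_of_mass_ne_top hS).restrictSet {x | r < v x} (measurableSet_lt_of_continuous hv r)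

/-- `S ⌞ {r' < v ≤ r}`. [cite: Federer1969, 4.2.2] -/
def Current.restrictShell (S : Current (⊤ : Opens V) (d + 1)) (hS : S.mass ≠ ⊤) (hv : Continuous v)
    (r' r : ℝ) : Current (⊤ : Opens V) (d + 1) :=
  (S.isRepresentable_of_mass_ne_top hS).restrictSet {x | r' < v x ∧ v x ≤ r} (measurableSet_shell hv r' r)

/-- `𝐌(S ⌞ A) < ∞`. [folklore] -/
theorem Current.mass_restrictSet_ne_top' {m : ℕ} {Ω : Opens V} {T : Current Ω m} (hT : T.IsRepresentable)
    (hTm : T.mass ≠ ⊤) {A : Set V} (hA : MeasurableSet A) : (hT.restrictSet A hA).mass ≠ ⊤ :=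
  ne_top_of_le_ne_top hTm ((hT.mass_restrictSet_le hA).trans (T.variation_le_mass A))

variable {S : Current (⊤ : Opens V) (d + 1)}

/-- `𝐌(S ⌞ {v > r}) < ∞`. [folklore] -/
theorem Current.mass_restrictAbove_ne_top (hS : S.mass ≠ ⊤) (hv : Continuous v) (r : ℝ) :
    (S.restrictAbove hS hv r).mass ≠ ⊤ :=
  Current.mass_restrictSet_ne_top' _ hS _

/-- `𝐌(S ⌞ shell) < ∞`. [folklore] -/
theorem Current.mass_restrictShell_ne_top (hS : S.mass ≠ ⊤) (hv : Continuous v) (r' r : ℝ) :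
    (S.restrictShell hS hv r' r).mass ≠ ⊤ :=
  Current.mass_restrictSet_ne_top' _ hS _

/-- `spt (S ⌞ {v > r})` is compact. [folklore] -/
theorem Current.isCompact_support_restrictAbove (hS : S.mass ≠ ⊤) (hsupp : IsCompact S.support)
    (hv : Continuous v) (r : ℝ) : IsCompact (S.restrictAbove hS hv r).support :=
  Current.isCompact_support_of_subset _ hsupp S.support_subset
    ((S.isRepresentable_of_mass_ne_top hS).support_restrictSet_subset _)

/-- `spt (S ⌞ shell)` is compact. [folklore] -/
theorem Current.isCompact_support_restrictShell (hS : S.mass ≠ ⊤) (hsupp : IsCompact S.support)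
    (hv : Continuous v) (r' r : ℝ) : IsCompact (S.restrictShell hS hv r' r).support :=
  Current.isCompact_support_of_subset _ hsupp S.support_subset
    ((S.isRepresentable_of_mass_ne_top hS).support_restrictSet_subset _)

/-- `spt (S ⌞ {v > r}) ⊆ {v ≥ r}`. [folklore] -/
theorem Current.support_restrictAbove_subset (hS : S.mass ≠ ⊤) (hv : Continuous v) (r : ℝ) :
    (S.restrictAbove hS hv r).support ⊆ {x | r ≤ v x} :=
  (Current.IsRepresentable.support_restrictSet_subset_closure (S.isRepresentable_of_mass_ne_top hS) _).trans
    (closure_minimal (fun x (hx : r < v x) => show r ≤ v x from hx.le) (isClosed_le continuous_const hv))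

/-- `spt (S ⌞ {r' < v ≤ r}) ⊆ {v ≥ r'}`. [folklore] -/
theorem Current.support_restrictShell_subset (hS : S.mass ≠ ⊤) (hv : Continuous v) (r' r : ℝ) :
    (S.restrictShell hS hv r' r).support ⊆ {x | r' ≤ v x} :=
  (Current.IsRepresentable.support_restrictSet_subset_closure (S.isRepresentable_of_mass_ne_top hS) _).trans
    (closure_minimal (fun x (hx : r' < v x ∧ v x ≤ r) => show r' ≤ v x from hx.1.le)
      (isClosed_le continuous_const hv))

/-- **Shell decomposition**: `S ⌞ {v > r'} = S ⌞ {v > r} + S ⌞ {r' < v ≤ r}` for `r' ≤ r`.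
[cite: Federer1969, 4.2.2] -/
theorem Current.restrictAbove_eq_add_shell (hS : S.mass ≠ ⊤) (hv : Continuous v) {r' r : ℝ}
    (hle : r' ≤ r) :
    S.restrictAbove hS hv r' = S.restrictAbove hS hv r + S.restrictShell hS hv r' r := by
  unfold Current.restrictAbove Current.restrictShell
  rw [← (S.isRepresentable_of_mass_ne_top hS).restrictSet_union]
  · congr 1
    ext x
    simp only [Set.mem_setOf_eq, Set.mem_union]
    constructor
    · intro h
      by_cases h' : r < v x
      · exact Or.inl h'
      · exact Or.inr ⟨h, not_lt.1 h'⟩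
    · rintro (h | h)
      · exact lt_of_le_of_lt hle h
      · exact h.1
  · exact Set.disjoint_left.2 fun x (hx : r < v x) hx' => (not_le.2 hx) hx'.2

/-- Hence `∂(S ⌞ shell)` has finite mass when both `∂(S ⌞ {v > r'})` and `∂(S ⌞ {v > r})` do.
[folklore] -/
theorem Current.mass_boundary_restrictShell_ne_top (hS : S.mass ≠ ⊤) (hv : Continuous v) {r' r : ℝ}
    (hle : r' ≤ r) (h' : (S.restrictAbove hS hv r').boundary.mass ≠ ⊤)
    (h : (S.restrictAbove hS hv r).boundary.mass ≠ ⊤) :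
    (S.restrictShell hS hv r' r).boundary.mass ≠ ⊤ := by
  have e : S.restrictShell hS hv r' r = S.restrictAbove hS hv r' - S.restrictAbove hS hv r := by
    rw [S.restrictAbove_eq_add_shell hS hv hle]; abel
  rw [e, sub_eq_add_neg, Current.boundary_add, Current.boundary_neg]
  refine ne_top_of_le_ne_top (ENNReal.add_ne_top.2 ⟨h', ?_⟩) (Current.mass_add_le _ _)
  rwa [Current.mass_neg]

/-! ### The restricted push-forwards `P_r` and the shell identity -/

/-- **`P_r = (G_r)_# (S ⌞ {v > r})`** for a good radius `r` (finite boundary mass of the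
restriction). [cite: Federer1969, 4.2.2] -/
def Current.admPush (b : OrthonormalBasis (Fin n) ℝ V) (S : Current (⊤ : Opens V) (d + 1))
    (hS : S.mass ≠ ⊤) (hsupp : IsCompact S.support) (hv : Continuous v) (hadm : Admissible v g C)
    (hC : 0 ≤ C) {r : ℝ} (hr : 0 < r) (hgood : (S.restrictAbove hS hv r).boundary.mass ≠ ⊤) :
    Current (⊤ : Opens V) (d + 1) :=
  (S.restrictAbove hS hv r).lipPushforward (S.mass_restrictAbove_ne_top hS hv r) hgood
    (S.isCompact_support_restrictAbove hS hsupp hv r) (hadm.lipschitzWith_ext b hC hr) ⊤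

/-- The push-forward of a shell by `G_{r'}`. [cite: Federer1969, 4.2.2] -/
def Current.admPushShell (b : OrthonormalBasis (Fin n) ℝ V) (S : Current (⊤ : Opens V) (d + 1))
    (hS : S.mass ≠ ⊤) (hsupp : IsCompact S.support) (hv : Continuous v) (hadm : Admissible v g C)
    (hC : 0 ≤ C) {r' : ℝ} (r : ℝ) (hr' : 0 < r') (hbd : (S.restrictShell hS hv r' r).boundary.mass ≠ ⊤) :
    Current (⊤ : Opens V) (d + 1) :=
  (S.restrictShell hS hv r' r).lipPushforward (S.mass_restrictShell_ne_top hS hv r' r) hbd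
    (S.isCompact_support_restrictShell hS hsupp hv r' r) (hadm.lipschitzWith_ext b hC hr') ⊤

/-- `P_r` computed with the finer extension `G_{r'}` (`r' ≤ r`), which agrees with `G_r` on the open
set `{v > r/2} ⊇ spt (S ⌞ {v > r})`. [cite: Federer1969, 4.2.2] -/
theorem Current.admPush_eq_finer (b : OrthonormalBasis (Fin n) ℝ V) (hS : S.mass ≠ ⊤)
    (hsupp : IsCompact S.support) (hv : Continuous v) (hadm : Admissible v g C) (hC : 0 ≤ C)
    {r' r : ℝ} (hr' : 0 < r') (hr : 0 < r) (hle : r' ≤ r)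
    (hg : (S.restrictAbove hS hv r).boundary.mass ≠ ⊤) :
    S.admPush b hS hsupp hv hadm hC hr hg =
      (S.restrictAbove hS hv r).lipPushforward (S.mass_restrictAbove_ne_top hS hv r) hg
        (S.isCompact_support_restrictAbove hS hsupp hv r) (hadm.lipschitzWith_ext b hC hr') ⊤ :=
  (S.restrictAbove hS hv r).lipPushforward_congr _ hg _ (hadm.lipschitzWith_ext b hC hr)
    (hadm.lipschitzWith_ext b hC hr') (isOpen_lt continuous_const hv)
    ((S.support_restrictAbove_subset hS hv r).trans fun x hx => by
      show r / 2 < v x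
      have : r ≤ v x := hx
      linarith)
    (hadm.ext_eqOn_ext b hC hr hr' hle)

/-- **The shell identity**: for good radii `r' ≤ r`, `P_{r'} − P_r = (G_{r'})_# (S ⌞ {r' < v ≤ r})`.
[cite: Federer1969, 4.2.2] -/
theorem Current.admPush_sub_admPush (b : OrthonormalBasis (Fin n) ℝ V) (hS : S.mass ≠ ⊤)
    (hsupp : IsCompact S.support) (hv : Continuous v) (hadm : Admissible v g C) (hC : 0 ≤ C)
    {r' r : ℝ} (hr' : 0 < r') (hr : 0 < r) (hle : r' ≤ r)
    (hg' : (S.restrictAbove hS hv r').boundary.mass ≠ ⊤) (hg : (S.restrictAbove hS hv r).boundary.mass ≠ ⊤) :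
    S.admPush b hS hsupp hv hadm hC hr' hg' - S.admPush b hS hsupp hv hadm hC hr hg =
      S.admPushShell b hS hsupp hv hadm hC r hr' (S.mass_boundary_restrictShell_ne_top hS hv hle hg' hg) := by
  rw [S.admPush_eq_finer b hS hsupp hv hadm hC hr' hr hle hg, sub_eq_iff_eq_add']
  have hbd := S.mass_boundary_restrictShell_ne_top hS hv hle hg' hg
  have key := Current.lipPushforward_add' (Ω' := (⊤ : Opens V))
    (T₁ := S.restrictAbove hS hv r) (T₂ := S.restrictShell hS hv r' r)
    (S.mass_restrictAbove_ne_top hS hv r) hg (S.isCompact_support_restrictAbove hS hsupp hv r)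
    (S.mass_restrictShell_ne_top hS hv r' r) hbd (S.isCompact_support_restrictShell hS hsupp hv r' r)
    (by rw [← S.restrictAbove_eq_add_shell hS hv hle]; exact S.mass_restrictAbove_ne_top hS hv r')
    (by rw [← S.restrictAbove_eq_add_shell hS hv hle]; exact hg')
    (by rw [← S.restrictAbove_eq_add_shell hS hv hle]; exact S.isCompact_support_restrictAbove hS hsupp hv r')
    (hadm.lipschitzWith_ext b hC hr')
  unfold Current.admPush Current.admPushShell
  rw [← key]
  congr 1
  exact S.restrictAbove_eq_add_shell hS hv hle

end AdmissibleA

/-! ## The admissible push-forward — Part B: shell estimates, good radii, the limit current -/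

section AdmissibleB

open Cubical

variable {V : Type*} [NormedAddCommGroup V] [InnerProductSpace ℝ V] [FiniteDimensional ℝ V]
  [MeasurableSpace V] [BorelSpace V] {n d : ℕ} {v : V → ℝ} {g : V → V} {C : ℝ}
  {S : Current (⊤ : Opens V) (d + 1)}

/-- The weight `w = (1/v)^{d+1}` (`= ∞` where `v ≤ 0`). [cite: Federer1969, 4.2.2] -/
def admWeight (v : V → ℝ) (d : ℕ) (x : V) : ℝ≥0∞ := (ENNReal.ofReal (v x))⁻¹ ^ (d + 1)

/-- The constant `(8 C √n)^{d+1}`. [cite: Federer1969, 4.2.2] -/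
def admConst (n : ℕ) (C : ℝ) (d : ℕ) : ℝ≥0∞ := ENNReal.ofReal (8 * C * Real.sqrt n) ^ (d + 1)

omit [InnerProductSpace ℝ V] [FiniteDimensional ℝ V] in
/-- The weight is measurable. [folklore] -/
theorem measurable_admWeight (hv : Continuous v) : Measurable (admWeight v d) :=
  ((ENNReal.measurable_ofReal.comp hv.measurable).inv).pow_const _

omit [NormedAddCommGroup V] [InnerProductSpace ℝ V] [FiniteDimensional ℝ V] [MeasurableSpace V] [BorelSpace V] in
/-- **Pointwise comparison of the Lipschitz constant with the weight**: where `0 < v ≤ 4 r'`,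
`(extConst n C r')^{d+1} ≤ (8 C √n)^{d+1} (1/v)^{d+1}`. [cite: Federer1969, 4.2.2] -/
theorem extConst_pow_le_admConst_mul (hC : 0 ≤ C) {r' : ℝ} (hr' : 0 < r') {x : V}
    (hv0 : 0 < v x) (hx : v x ≤ 4 * r') :
    (extConst n C r' : ℝ≥0∞) ^ (d + 1) ≤ admConst n C d * admWeight v d x := by
  unfold admConst admWeight
  rw [← mul_pow]
  gcongr
  rw [← ENNReal.ofReal_inv_of_pos hv0, ← ENNReal.ofReal_mul (by positivity),
    ← ENNReal.ofReal_coe_nnreal]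
  refine ENNReal.ofReal_le_ofReal ?_
  unfold extConst
  rw [NNReal.coe_mul, Real.coe_sqrt, NNReal.coe_natCast,
    Real.coe_toNNReal _ (div_nonneg hC (half_pos hr').le)]
  have key : Real.sqrt n * (C / (r' / 2)) = 2 * C * Real.sqrt n / r' := by
    field_simp
  rw [key, ← div_eq_mul_inv, div_le_div_iff₀ hr' hv0]
  have : 0 ≤ C * Real.sqrt n := mul_nonneg hC (Real.sqrt_nonneg _)
  nlinarith

/-- **Shell mass estimate**: `𝐌((G_{r'})_# (S ⌞ shell)) ≤ (extConst r')^{d+1} ‖S‖(shell)`.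
[cite: Federer1969, 4.2.2] -/
theorem Current.mass_admPushShell_le (b : OrthonormalBasis (Fin n) ℝ V) (hS : S.mass ≠ ⊤)
    (hsupp : IsCompact S.support) (hv : Continuous v) (hadm : Admissible v g C) (hC : 0 ≤ C)
    {r' : ℝ} (r : ℝ) (hr' : 0 < r') (hbd : (S.restrictShell hS hv r' r).boundary.mass ≠ ⊤) :
    (S.admPushShell b hS hsupp hv hadm hC r hr' hbd).mass ≤
      (extConst n C r' : ℝ≥0∞) ^ (d + 1) * S.variation {x | r' < v x ∧ v x ≤ r} := by
  refine (Current.mass_lipPushforward_le _ _ hbd _ _).trans (mul_le_mul' le_rfl ?_)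
  exact ((S.isRepresentable_of_mass_ne_top hS).mass_restrictSet_le _).trans le_rfl

/-- **Shell mass estimate, integral form**: for `r ≤ 4 r'`,
`𝐌((G_{r'})_# (S ⌞ {r' < v ≤ r})) ≤ (8C√n)^{d+1} ∫_{shell} (1/v)^{d+1} d‖S‖`.
[cite: Federer1969, 4.2.2] -/
theorem Current.mass_admPushShell_le_lintegral (b : OrthonormalBasis (Fin n) ℝ V) (hS : S.mass ≠ ⊤)
    (hsupp : IsCompact S.support) (hv : Continuous v) (hadm : Admissible v g C) (hC : 0 ≤ C)
    {r' r : ℝ} (hr' : 0 < r') (hr4 : r ≤ 4 * r') (hbd : (S.restrictShell hS hv r' r).boundary.mass ≠ ⊤) :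
    (S.admPushShell b hS hsupp hv hadm hC r hr' hbd).mass ≤
      admConst n C d * ∫⁻ x in {x | r' < v x ∧ v x ≤ r}, admWeight v d x ∂S.variation := by
  refine (S.mass_admPushShell_le b hS hsupp hv hadm hC r hr' hbd).trans ?_
  calc (extConst n C r' : ℝ≥0∞) ^ (d + 1) * S.variation {x | r' < v x ∧ v x ≤ r}
      = ∫⁻ _ in {x | r' < v x ∧ v x ≤ r}, (extConst n C r' : ℝ≥0∞) ^ (d + 1) ∂S.variation :=
        (setLIntegral_const _ _).symm
    _ ≤ ∫⁻ x in {x | r' < v x ∧ v x ≤ r}, admConst n C d * admWeight v d x ∂S.variation :=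
        setLIntegral_mono (measurable_const.mul (measurable_admWeight hv)) fun x hx =>
          extConst_pow_le_admConst_mul hC hr' (hr'.trans hx.1) (hx.2.trans hr4)
    _ = admConst n C d * ∫⁻ x in {x | r' < v x ∧ v x ≤ r}, admWeight v d x ∂S.variation :=
        lintegral_const_mul _ (measurable_admWeight hv)

/-- Likewise for the top piece: if `v ≤ 4 r` everywhere on `{v > r}` (e.g. `v ≤ ε ≤ 2r`), then
`𝐌(P_r) ≤ (8C√n)^{d+1} ∫_{v > r} (1/v)^{d+1} d‖S‖`. [cite: Federer1969, 4.2.2] -/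
theorem Current.mass_admPush_le_lintegral (b : OrthonormalBasis (Fin n) ℝ V) (hS : S.mass ≠ ⊤)
    (hsupp : IsCompact S.support) (hv : Continuous v) (hadm : Admissible v g C) (hC : 0 ≤ C)
    {r : ℝ} (hr : 0 < r) (hv4 : ∀ x, v x ≤ 4 * r) (hgood : (S.restrictAbove hS hv r).boundary.mass ≠ ⊤) :
    (S.admPush b hS hsupp hv hadm hC hr hgood).mass ≤
      admConst n C d * ∫⁻ x in {x | r < v x}, admWeight v d x ∂S.variation := by
  have h1 : (S.admPush b hS hsupp hv hadm hC hr hgood).mass ≤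
      (extConst n C r : ℝ≥0∞) ^ (d + 1) * S.variation {x | r < v x} := by
    refine (Current.mass_lipPushforward_le _ _ hgood _ _).trans (mul_le_mul' le_rfl ?_)
    exact (S.isRepresentable_of_mass_ne_top hS).mass_restrictSet_le _
  refine h1.trans ?_
  calc (extConst n C r : ℝ≥0∞) ^ (d + 1) * S.variation {x | r < v x}
      = ∫⁻ _ in {x | r < v x}, (extConst n C r : ℝ≥0∞) ^ (d + 1) ∂S.variation :=
        (setLIntegral_const _ _).symm
    _ ≤ ∫⁻ x in {x | r < v x}, admConst n C d * admWeight v d x ∂S.variation :=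
        setLIntegral_mono (measurable_const.mul (measurable_admWeight hv)) fun x hx =>
          extConst_pow_le_admConst_mul hC hr (hr.trans hx) (hv4 x)
    _ = admConst n C d * ∫⁻ x in {x | r < v x}, admWeight v d x ∂S.variation :=
        lintegral_const_mul _ (measurable_admWeight hv)

/-! ### Good sequences of radii -/

/-- **A good dyadic sequence of radii** for `S` and `v` at scale `ε`: `r_j ∈ (ε 2^{-j-1}, ε 2^{-j}]`
with `∂(S ⌞ {v > r_j})` of finite mass, and satisfying an auxiliary a.e. property `P`.
[cite: Federer1969, 4.2.2] -/
structure Current.GoodSeq (S : Current (⊤ : Opens V) (d + 1)) (hS : S.mass ≠ ⊤) (hv : Continuous v)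
    (ε : ℝ) (P : ℝ → Prop) where
  /-- the radii -/
  r : ℕ → ℝ
  lower : ∀ j, ε / 2 ^ (j + 1) < r j
  upper : ∀ j, r j ≤ ε / 2 ^ j
  good : ∀ j, (S.restrictAbove hS hv (r j)).boundary.mass ≠ ⊤
  prop : ∀ j, P (r j)

namespace Current.GoodSeq

variable {hS : S.mass ≠ ⊤} {hv : Continuous v} {ε : ℝ} {P : ℝ → Prop}
  (R : S.GoodSeq hS hv ε P)

/-- The radii are positive. [folklore] -/
theorem pos (hε : 0 < ε) (j : ℕ) : 0 < R.r j := lt_trans (by positivity) (R.lower j)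

/-- The radii decrease. [folklore] -/
theorem succ_le (j : ℕ) : R.r (j + 1) ≤ R.r j := (R.upper (j + 1)).trans (R.lower j).le

/-- Consecutive radii have ratio `≤ 4`. [folklore] -/
theorem le_four_mul_succ (hε : 0 < ε) (j : ℕ) : R.r j ≤ 4 * R.r (j + 1) := by
  have h1 := R.upper j
  have h2 := R.lower (j + 1)
  have : ε / 2 ^ j = 4 * (ε / 2 ^ (j + 1 + 1)) := by rw [pow_succ, pow_succ]; field_simp; ring
  linarith

/-- The radii are antitone. [folklore] -/
theorem antitone : Antitone R.r := antitone_nat_of_succ_le R.succ_le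

/-- The radii tend to `0`. [folklore] -/
theorem tendsto_zero (hε : 0 < ε) : Tendsto R.r atTop (𝓝 0) := by
  refine squeeze_zero (fun j => (R.pos hε j).le) R.upper ?_
  have : Tendsto (fun j : ℕ => ε * (1 / 2) ^ j) atTop (𝓝 (ε * 0)) :=
    (tendsto_pow_atTop_nhds_zero_of_lt_one (by norm_num) (by norm_num)).const_mul ε
  rw [mul_zero] at this
  refine this.congr fun j => ?_
  rw [one_div, inv_pow, div_eq_mul_inv]

end Current.GoodSeq

/-- **Good sequences exist** for a normal current and a `1`-Lipschitz control function, with any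
auxiliary almost-sure property (Lipschitz slicing: `∂(S ⌞ {v > r})` has finite mass for a.e. `r`).
[cite: Federer1969, 4.2.1, 4.2.2] -/
theorem Current.exists_goodSeq (hS : S.mass ≠ ⊤) (hdS : S.boundary.mass ≠ ⊤) {L : ℝ≥0}
    (hv : LipschitzWith L v) {ε : ℝ} (hε : 0 < ε) {P : ℝ → Prop}
    (hP : ∀ᵐ r ∂(volume : Measure ℝ), P r) : Nonempty (S.GoodSeq hS hv.continuous ε P) := by
  have hT := S.isRepresentable_of_mass_ne_top hS
  have hdT := S.boundary.isRepresentable_of_mass_ne_top hdS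
  have hgood := hT.ae_mass_boundary_restrictSet_lt_top hdT hv hS hdS
  have hall : ∀ᵐ r ∂(volume : Measure ℝ), P r ∧
      (hT.restrictSet {x | r < v x} (measurableSet_lt_of_continuous hv.continuous r)).boundary.mass < ⊤ :=
    hP.and hgood
  have hex : ∀ j : ℕ, ∃ r ∈ Set.Ioc (ε / 2 ^ (j + 1)) (ε / 2 ^ j), P r ∧
      (hT.restrictSet {x | r < v x} (measurableSet_lt_of_continuous hv.continuous r)).boundary.mass < ⊤ := by
    intro j
    have hI : volume (Set.Ioc (ε / 2 ^ (j + 1)) (ε / 2 ^ j)) ≠ 0 := by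
      rw [Real.volume_Ioc, ne_eq, ENNReal.ofReal_eq_zero, not_le, sub_pos]
      rw [pow_succ]
      exact div_lt_div_of_pos_left hε (by positivity) (by linarith [pow_pos (show (0:ℝ) < 2 by norm_num) j])
    have h' : ∃ᵐ r ∂(volume : Measure ℝ), r ∈ Set.Ioc (ε / 2 ^ (j + 1)) (ε / 2 ^ j) :=
      frequently_ae_mem_iff.2 hI
    obtain ⟨r, hr, hrI⟩ := (h'.and_eventually hall).exists
    exact ⟨r, hr, hrI⟩
  choose r hrI hrP using hex
  exact ⟨⟨r, fun j => (hrI j).1, fun j => (hrI j).2, fun j => (hrP j).2.ne, fun j => (hrP j).1⟩⟩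


/-- The minimum of two good sequences is a good sequence. [folklore] -/
def Current.GoodSeq.min {hS : S.mass ≠ ⊤} {hv : Continuous v} {ε : ℝ} {P : ℝ → Prop}
    (R : S.GoodSeq hS hv ε P) {P' : ℝ → Prop}
    (R' : S.GoodSeq hS hv ε P') : S.GoodSeq hS hv ε (fun _ => True) where
  r j := Min.min (R.r j) (R'.r j)
  lower j := lt_min (R.lower j) (R'.lower j)
  upper j := (min_le_left _ _).trans (R.upper j)
  good j := by
    rcases min_choice (R.r j) (R'.r j) with h | h
    · simp only [h]; exact R.good j
    · simp only [h]; exact R'.good j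
  prop _ := trivial

/-- The shells of a good sequence are pairwise disjoint. [folklore] -/
theorem Current.GoodSeq.pairwise_disjoint_shell {hS : S.mass ≠ ⊤} {hv : Continuous v} {ε : ℝ}
    {P : ℝ → Prop} (R : S.GoodSeq hS hv ε P) :
    Pairwise (Function.onFun Disjoint fun j => {x : V | R.r (j + 1) < v x ∧ v x ≤ R.r j}) := by
  intro i j hij
  wlog h : i < j generalizing i j
  · exact (this hij.symm (lt_of_le_of_ne (not_lt.1 h) hij.symm)).symm
  refine Set.disjoint_left.2 fun x hx hx' => ?_
  have h1 : R.r j ≤ R.r (i + 1) := R.antitone (Nat.succ_le_of_lt h)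
  exact lt_irrefl (v x) ((hx'.2.trans h1).trans_lt hx.1)

end AdmissibleB

/-! ## The admissible push-forward — Part B2: shell families and their limits

The passage to the limit `r → 0+` in [Federer1969, 4.2.2] is the same for `f_# (T ⌞ U_r)` and for
the homotopies `h_# ([0,1] × T ⌞ U_r)`: an abstract **shell family** records approximants `Ψ_r`
indexed by good radii together with the two mass estimates (shell differences and the top piece are
bounded by `K ∫ w d‖S‖` over the shell / the superlevel set); the limit along a good dyadic
sequence exists when `∫ w d‖S‖ < ∞`, has mass `≤ K ∫ w d‖S‖`, and does not depend on the sequence. -/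

section WeakLimitCurrent

variable {E' : Type*} [NormedAddCommGroup E'] [NormedSpace ℝ E'] [FiniteDimensional ℝ E']
  {Ω' : Opens E'} {k : ℕ}

/-- **A linear functional on test forms bounded by the sup norm is a current**:
`|L φ| ≤ M sup‖φ‖` bounds `L` by the `C⁰`-seminorm on each `𝓓_K`. [cite: Federer1969, 4.1.7] -/
def Current.ofSupNormBound (L : TestForm Ω' k →ₗ[ℝ] ℝ) (M : ℝ)
    (hL : ∀ (φ : TestForm Ω' k) (c : ℝ), 0 ≤ c → (∀ y, ‖φ y‖ ≤ c) → |L φ| ≤ c * M) : Current Ω' k :=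
  TestFunction.mkCLM ℝ L (fun φ ψ => map_add L φ ψ) (fun c φ => map_smul L c φ) fun K hK => by
      let ℓ : 𝓓_{K}(E', Covector E' k) →ₗ[ℝ] ℝ :=
        { toFun := fun ψ => L (TestFunction.ofSupportedInCLM ℝ hK ψ)
          map_add' := fun ψ ψ' => by rw [map_add, map_add]
          map_smul' := fun c ψ => by rw [map_smul, map_smul]; rfl }
      have hcont : Continuous ℓ :=
        WithSeminorms.continuous_of_isBounded
          (ContDiffMapSupportedIn.withSeminorms ℝ E' (Covector E' k) ⊤ K)
          (norm_withSeminorms ℝ ℝ) ℓ (.of_real fun _ => ⟨{0}, M, fun ψ => by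
              show ‖L (TestFunction.ofSupportedIn hK ψ)‖ ≤ _
              rw [Real.norm_eq_abs, Finset.sup_singleton]
              have hb : ∀ y, ‖(TestFunction.ofSupportedIn hK ψ : TestForm Ω' k) y‖ ≤
                  ContDiffMapSupportedIn.seminorm ℝ E' (Covector E' k) ⊤ K 0 ψ := fun y => by
                have := ContDiffMapSupportedIn.norm_iteratedFDeriv_apply_le_seminorm ℝ
                  (n := ⊤) (i := 0) (mod_cast le_top) (f := ψ) (x := y)
                rwa [norm_iteratedFDeriv_zero] at this
              have h := hL (TestFunction.ofSupportedIn hK ψ) _ (apply_nonneg _ _) hb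
              linarith [h]⟩)
      exact hcont

omit [FiniteDimensional ℝ E'] in
/-- Unfolding `ofSupNormBound`. [folklore] -/
@[simp] theorem Current.ofSupNormBound_apply (L : TestForm Ω' k →ₗ[ℝ] ℝ) (M : ℝ)
    (hL : ∀ (φ : TestForm Ω' k) (c : ℝ), 0 ≤ c → (∀ y, ‖φ y‖ ≤ c) → |L φ| ≤ c * M) (φ : TestForm Ω' k) :
    Current.ofSupNormBound L M hL φ = L φ := rfl

/-- **Weak limits of currents of uniformly bounded mass are currents**: if `T_j(φ)` converges for
every `φ` and `𝐌(T_j) ≤ M < ∞`, the pointwise limit is a current. [cite: Federer1969, 4.1.7] -/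
def Current.weakLim (T : ℕ → Current Ω' k) (M : ℝ≥0∞) (hM : M ≠ ⊤) (hT : ∀ j, (T j).mass ≤ M)
    (hconv : ∀ φ, ∃ l, Tendsto (fun j => T j φ) atTop (𝓝 l)) : Current Ω' k :=
  Current.ofSupNormBound
    { toFun := fun φ => limUnder atTop fun j => T j φ
      map_add' := fun φ ψ => by
        have h1 := tendsto_nhds_limUnder (hconv φ)
        have h2 := tendsto_nhds_limUnder (hconv ψ)
        refine tendsto_nhds_unique (tendsto_nhds_limUnder (hconv (φ + ψ))) ?_
        simp_rw [map_add]; exact h1.add h2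
      map_smul' := fun c φ => by
        refine tendsto_nhds_unique (tendsto_nhds_limUnder (hconv (c • φ))) ?_
        simp_rw [map_smul]; exact (tendsto_nhds_limUnder (hconv φ)).const_smul c }
    M.toReal fun φ c hc hφ => by
      refine le_of_tendsto ((continuous_abs.tendsto _).comp (tendsto_nhds_limUnder (hconv φ)))
        (Eventually.of_forall fun j => ?_)
      have hfin : (T j).mass ≠ ⊤ := ne_top_of_le_ne_top hM (hT j)
      exact ((T j).abs_apply_le_mul_toReal_mass' hfin hc hφ).trans
        (mul_le_mul_of_nonneg_left (ENNReal.toReal_mono hM (hT j)) hc)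

omit [FiniteDimensional ℝ E'] in
/-- The weak limit is the pointwise limit. [folklore] -/
theorem Current.tendsto_weakLim (T : ℕ → Current Ω' k) (M : ℝ≥0∞) (hM : M ≠ ⊤)
    (hT : ∀ j, (T j).mass ≤ M) (hconv : ∀ φ, ∃ l, Tendsto (fun j => T j φ) atTop (𝓝 l))
    (φ : TestForm Ω' k) :
    Tendsto (fun j => T j φ) atTop (𝓝 (Current.weakLim T M hM hT hconv φ)) :=
  tendsto_nhds_limUnder (hconv φ)

omit [FiniteDimensional ℝ E'] in
/-- **`𝐌(lim T_j) ≤ M`.** [cite: Federer1969, 4.1.7] -/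
theorem Current.mass_weakLim_le (T : ℕ → Current Ω' k) (M : ℝ≥0∞) (hM : M ≠ ⊤)
    (hT : ∀ j, (T j).mass ≤ M) (hconv : ∀ φ, ∃ l, Tendsto (fun j => T j φ) atTop (𝓝 l)) :
    (Current.weakLim T M hM hT hconv).mass ≤ M :=
  (Current.mass_le_liminf (Current.tendsto_weakLim T M hM hT hconv)).trans
    (liminf_le_of_frequently_le' (Frequently.of_forall hT))

end WeakLimitCurrent

section ShellFamily

open Cubical

variable {V : Type*} [NormedAddCommGroup V] [InnerProductSpace ℝ V] [FiniteDimensional ℝ V]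
  [MeasurableSpace V] [BorelSpace V] {d k : ℕ} {v : V → ℝ} {S : Current (⊤ : Opens V) (d + 1)}

/-- **A shell family** for `S` and `v`: approximants `Ψ_r` at good radii with the shell estimate
`𝐌(Ψ_{r'} − Ψ_r) ≤ K ∫_{r' < v ≤ r} w d‖S‖` (`r' ≤ r ≤ 4 r'`) and the top estimate
`𝐌(Ψ_r) ≤ K ∫_{v > r} w d‖S‖` (`v ≤ 4 r`). [cite: Federer1969, 4.2.2] -/
structure Current.ShellFamily (S : Current (⊤ : Opens V) (d + 1)) (hS : S.mass ≠ ⊤) (hv : Continuous v)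
    (k : ℕ) where
  /-- the approximants at good radii -/
  Ψ : ∀ r : ℝ, 0 < r → (S.restrictAbove hS hv r).boundary.mass ≠ ⊤ → Current (⊤ : Opens V) k
  /-- the constant -/
  K : ℝ≥0∞
  /-- the weight -/
  w : V → ℝ≥0∞
  K_ne_top : K ≠ ⊤
  measurable_w : Measurable w
  shell : ∀ {r' r : ℝ} (hr' : 0 < r') (hr : 0 < r), r' ≤ r → r ≤ 4 * r' →
    ∀ (hg' : (S.restrictAbove hS hv r').boundary.mass ≠ ⊤) (hg : (S.restrictAbove hS hv r).boundary.mass ≠ ⊤),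
      (Ψ r' hr' hg' - Ψ r hr hg).mass ≤ K * ∫⁻ x in {x | r' < v x ∧ v x ≤ r}, w x ∂S.variation
  top : ∀ {r : ℝ} (hr : 0 < r), (∀ x, v x ≤ 4 * r) → ∀ (hg : (S.restrictAbove hS hv r).boundary.mass ≠ ⊤),
      (Ψ r hr hg).mass ≤ K * ∫⁻ x in {x | r < v x}, w x ∂S.variation

namespace Current.ShellFamily

variable {hS : S.mass ≠ ⊤} {hv : Continuous v} (F : S.ShellFamily hS hv k) {ε : ℝ} (hε : 0 < ε)
  {P : ℝ → Prop} (R : S.GoodSeq hS hv ε P)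

/-- The sequence `Ψ_j = Ψ_{r_j}` along a good sequence. [cite: Federer1969, 4.2.2] -/
def seq (j : ℕ) : Current (⊤ : Opens V) k := F.Ψ (R.r j) (R.pos hε j) (R.good j)

/-- **Telescoping estimate**: `𝐌(Ψ_{j+1} − Ψ_j) ≤ K ∫_{shell_j} w d‖S‖`. [cite: Federer1969, 4.2.2] -/
theorem mass_seq_succ_sub_le (j : ℕ) :
    (F.seq hε R (j + 1) - F.seq hε R j).mass ≤
      F.K * ∫⁻ x in {x | R.r (j + 1) < v x ∧ v x ≤ R.r j}, F.w x ∂S.variation :=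
  F.shell (R.pos hε (j + 1)) (R.pos hε j) (R.succ_le j) (R.le_four_mul_succ hε j) _ _

/-- **Uniform mass bound**: `𝐌(Ψ_j) ≤ K ∫_{v > r_j} w d‖S‖` (`v ≤ ε < 2 r_0`). [cite: Federer1969, 4.2.2] -/
theorem mass_seq_le (hvε : ∀ x, v x ≤ ε) (j : ℕ) :
    (F.seq hε R j).mass ≤ F.K * ∫⁻ x in {x | R.r j < v x}, F.w x ∂S.variation := by
  induction j with
  | zero =>
    refine F.top (R.pos hε 0) (fun x => ?_) (R.good 0)
    have h := R.lower 0
    rw [zero_add, pow_one] at h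
    linarith [hvε x]
  | succ j ih =>
    have e : F.seq hε R (j + 1) = F.seq hε R j + (F.seq hε R (j + 1) - F.seq hε R j) := by abel
    rw [e]
    refine (Current.mass_add_le _ _).trans ?_
    refine (add_le_add ih (F.mass_seq_succ_sub_le hε R j)).trans ?_
    have hset : {x | R.r (j + 1) < v x} = {x | R.r j < v x} ∪ {x | R.r (j + 1) < v x ∧ v x ≤ R.r j} := by
      ext x
      simp only [Set.mem_union, Set.mem_setOf_eq]
      constructor
      · intro h
        by_cases h' : R.r j < v x
        · exact Or.inl h'
        · exact Or.inr ⟨h, not_lt.1 h'⟩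
      · rintro (h | h)
        · exact lt_of_le_of_lt (R.succ_le j) h
        · exact h.1
    rw [← mul_add, hset]
    refine mul_le_mul' le_rfl (le_of_eq ?_)
    exact (lintegral_union (measurableSet_shell hv _ _)
      (Set.disjoint_left.2 fun x (hx : R.r j < v x) hx' => (not_le.2 hx) hx'.2)).symm

/-- Hence `𝐌(Ψ_j) ≤ K ∫ w d‖S‖`. [cite: Federer1969, 4.2.2] -/
theorem mass_seq_le' (hvε : ∀ x, v x ≤ ε) (j : ℕ) :
    (F.seq hε R j).mass ≤ F.K * ∫⁻ x, F.w x ∂S.variation :=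
  (F.mass_seq_le hε R hvε j).trans (mul_le_mul' le_rfl (setLIntegral_le_lintegral _ _))

/-- **Summability of the telescoping masses** (disjoint shells). [cite: Federer1969, 4.2.2] -/
theorem tsum_mass_seq_sub_le :
    ∑' j, (F.seq hε R (j + 1) - F.seq hε R j).mass ≤ F.K * ∫⁻ x, F.w x ∂S.variation := by
  calc ∑' j, (F.seq hε R (j + 1) - F.seq hε R j).mass
      ≤ ∑' j, F.K * ∫⁻ x in {x | R.r (j + 1) < v x ∧ v x ≤ R.r j}, F.w x ∂S.variation :=
        ENNReal.tsum_le_tsum fun j => F.mass_seq_succ_sub_le hε R j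
    _ = F.K * ∫⁻ x in ⋃ j, {x | R.r (j + 1) < v x ∧ v x ≤ R.r j}, F.w x ∂S.variation := by
        rw [ENNReal.tsum_mul_left, lintegral_iUnion (fun j => measurableSet_shell hv _ _)
          R.pairwise_disjoint_shell]
    _ ≤ F.K * ∫⁻ x, F.w x ∂S.variation := mul_le_mul' le_rfl (setLIntegral_le_lintegral _ _)

variable (hI : ∫⁻ x, F.w x ∂S.variation ≠ ⊤)

include hI in
/-- **`Ψ_j(φ)` is Cauchy.** [cite: Federer1969, 4.2.2] -/
theorem cauchySeq_seq_apply (φ : TestForm (⊤ : Opens V) k) : CauchySeq fun j => F.seq hε R j φ := by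
  obtain ⟨Cφ, hCφ, hφ⟩ := φ.exists_norm_le
  set a : ℕ → ℝ≥0∞ := fun j => (F.seq hε R (j + 1) - F.seq hε R j).mass
  have hsum : ∑' j, a j ≠ ⊤ :=
    ne_top_of_le_ne_top (ENNReal.mul_ne_top F.K_ne_top hI) (F.tsum_mass_seq_sub_le hε R)
  have hfin : ∀ j, a j ≠ ⊤ := fun j => ENNReal.ne_top_of_tsum_ne_top hsum j
  refine cauchySeq_of_dist_le_of_summable (fun j => Cφ * (a j).toReal) (fun j => ?_)
    ((ENNReal.summable_toReal hsum).mul_left Cφ)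
  rw [Real.dist_eq, abs_sub_comm]
  have := (F.seq hε R (j + 1) - F.seq hε R j).abs_apply_le_mul_toReal_mass (hfin j) hCφ hφ
  simpa using this

/-- **The limit of a shell family along a good sequence** (weak limit; it exists when
`∫ w d‖S‖ < ∞`). [cite: Federer1969, 4.2.2] -/
def lim (hvε : ∀ x, v x ≤ ε) (hI : ∫⁻ x, F.w x ∂S.variation ≠ ⊤) : Current (⊤ : Opens V) k :=
  Current.weakLim (F.seq hε R) (F.K * ∫⁻ x, F.w x ∂S.variation) (ENNReal.mul_ne_top F.K_ne_top hI)
    (F.mass_seq_le' hε R hvε) fun φ => cauchySeq_tendsto_of_complete (F.cauchySeq_seq_apply hε R hI φ)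

/-- `Ψ_j(φ) → (lim Ψ)(φ)`. [cite: Federer1969, 4.2.2] -/
theorem tendsto_seq (hvε : ∀ x, v x ≤ ε) (φ : TestForm (⊤ : Opens V) k) :
    Tendsto (fun j => F.seq hε R j φ) atTop (𝓝 (F.lim hε R hvε hI φ)) :=
  Current.tendsto_weakLim _ _ _ _ _ φ

/-- **`𝐌(lim Ψ) ≤ K ∫ w d‖S‖`.** [cite: Federer1969, 4.2.2] -/
theorem mass_lim_le (hvε : ∀ x, v x ≤ ε) : (F.lim hε R hvε hI).mass ≤ F.K * ∫⁻ x, F.w x ∂S.variation :=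
  Current.mass_weakLim_le _ _ _ _ _

/-- **Support of the limit** from supports of the approximants. [folklore] -/
theorem support_lim_subset (hvε : ∀ x, v x ≤ ε) {Z : Set V} (hZ : IsClosed Z)
    (h : ∀ j, (F.seq hε R j).support ⊆ Z) : (F.lim hε R hvε hI).support ⊆ Z :=
  Current.support_subset_of_tendsto (F.tendsto_seq hε R hI hvε) hZ h

/-! #### Independence of the good sequence -/

include hI in
/-- `‖S‖{w = ∞} = 0`-type fact: `‖S‖{v ≤ 0} = 0` when `w = ∞` on `{v ≤ 0}`. [cite: Federer1969, 4.2.2] -/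
theorem variation_nonpos_eq_zero (hw : ∀ x, v x ≤ 0 → F.w x = ⊤) : S.variation {x | v x ≤ 0} = 0 := by
  by_contra hne
  apply hI
  have hle : ∫⁻ x in {x | v x ≤ 0}, F.w x ∂S.variation ≤ ∫⁻ x, F.w x ∂S.variation :=
    setLIntegral_le_lintegral _ _
  refine eq_top_iff.2 (le_trans ?_ hle)
  have : ∫⁻ x in {x | v x ≤ 0}, F.w x ∂S.variation = ∫⁻ _ in {x | v x ≤ 0}, ⊤ ∂S.variation :=
    setLIntegral_congr_fun (isClosed_le hv continuous_const).measurableSet fun x hx => hw x hx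
  rw [this, setLIntegral_const, ENNReal.top_mul hne]

include hε hI in
/-- `‖S‖{v ≤ ε/2^j} → 0`. [folklore] -/
theorem tendsto_variation_sublevel (hw : ∀ x, v x ≤ 0 → F.w x = ⊤) :
    Tendsto (fun j : ℕ => S.variation {x | v x ≤ ε / 2 ^ j}) atTop (𝓝 0) := by
  have hanti : Antitone fun j : ℕ => {x | v x ≤ ε / 2 ^ j} := by
    intro i j hij x (hx : v x ≤ ε / 2 ^ j)
    show v x ≤ ε / 2 ^ i
    exact hx.trans (div_le_div_of_nonneg_left hε.le (by positivity) (pow_le_pow_right₀ (by norm_num) hij))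
  have h := tendsto_measure_iInter_atTop (μ := S.variation)
    (fun j => (isClosed_le hv continuous_const).measurableSet.nullMeasurableSet) hanti
    ⟨0, ne_top_of_le_ne_top hS (S.variation_le_mass _)⟩
  have hinter : ⋂ j : ℕ, {x | v x ≤ ε / 2 ^ j} = {x | v x ≤ 0} := by
    ext x
    simp only [Set.mem_iInter, Set.mem_setOf_eq]
    constructor
    · intro h
      by_contra hpos
      push Not at hpos
      obtain ⟨j, hj⟩ : ∃ j : ℕ, ε / 2 ^ j < v x := by
        have ht : Tendsto (fun j : ℕ => ε / 2 ^ j) atTop (𝓝 0) := by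
          have := (tendsto_pow_atTop_nhds_zero_of_lt_one (by norm_num : (0:ℝ) ≤ 1 / 2) (by norm_num)).const_mul ε
          rw [mul_zero] at this
          refine this.congr fun j => ?_
          rw [one_div, inv_pow, div_eq_mul_inv]
        exact (ht.eventually (gt_mem_nhds hpos)).exists
      exact (not_le.2 hj) (h j)
    · intro h j
      exact h.trans (by positivity)
  rw [hinter, F.variation_nonpos_eq_zero hI hw] at h
  exact h

include hI in
/-- **Comparison with a finer good sequence**: `Ψ'_j(φ) − Ψ_j(φ) → 0` if `r'_j ≤ r_j`.
[cite: Federer1969, 4.2.2] -/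
theorem tendsto_seq_sub_of_le (hw : ∀ x, v x ≤ 0 → F.w x = ⊤) {P' : ℝ → Prop}
    (R' : S.GoodSeq hS hv ε P') (hle : ∀ j, R'.r j ≤ R.r j) (φ : TestForm (⊤ : Opens V) k) :
    Tendsto (fun j => F.seq hε R' j φ - F.seq hε R j φ) atTop (𝓝 0) := by
  obtain ⟨Cφ, hCφ, hφ⟩ := φ.exists_norm_le
  have hmass : ∀ j, (F.seq hε R' j - F.seq hε R j).mass ≤
      F.K * ∫⁻ x in {x | v x ≤ ε / 2 ^ j}, F.w x ∂S.variation := by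
    intro j
    refine (F.shell (R'.pos hε j) (R.pos hε j) (hle j) ?_ _ _).trans
      (mul_le_mul' le_rfl (lintegral_mono_set fun x hx => hx.2.trans (R.upper j)))
    have h1 := R.upper j
    have h2 := R'.lower j
    have h3 := R'.pos hε j
    have : ε / 2 ^ j = 2 * (ε / 2 ^ (j + 1)) := by rw [pow_succ]; field_simp
    linarith
  have hne : ∀ j, F.K * ∫⁻ x in {x | v x ≤ ε / 2 ^ j}, F.w x ∂S.variation ≠ ⊤ := fun j =>
    ENNReal.mul_ne_top F.K_ne_top (ne_top_of_le_ne_top hI (setLIntegral_le_lintegral _ _))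
  have hfin : ∀ j, (F.seq hε R' j - F.seq hε R j).mass ≠ ⊤ := fun j => ne_top_of_le_ne_top (hne j) (hmass j)
  have hlim : Tendsto (fun j => F.K * ∫⁻ x in {x | v x ≤ ε / 2 ^ j}, F.w x ∂S.variation) atTop (𝓝 0) := by
    have h0 := tendsto_setLIntegral_zero (μ := S.variation) hI
      (s := fun j : ℕ => {x | v x ≤ ε / 2 ^ j}) (F.tendsto_variation_sublevel hε hI hw)
    have := ENNReal.Tendsto.const_mul (a := F.K) h0 (Or.inr F.K_ne_top)
    rwa [mul_zero] at this
  have hlim' : Tendsto (fun j => Cφ * (F.K * ∫⁻ x in {x | v x ≤ ε / 2 ^ j}, F.w x ∂S.variation).toReal)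
      atTop (𝓝 0) := by
    have := ((ENNReal.tendsto_toReal ENNReal.zero_ne_top).comp hlim).const_mul Cφ
    simpa using this
  refine squeeze_zero_norm (fun j => ?_) hlim'
  rw [Real.norm_eq_abs]
  have := (F.seq hε R' j - F.seq hε R j).abs_apply_le_mul_toReal_mass (hfin j) hCφ hφ
  refine (by simpa using this : |F.seq hε R' j φ - F.seq hε R j φ| ≤ _).trans ?_
  exact mul_le_mul_of_nonneg_left (ENNReal.toReal_mono (hne j) (hmass j)) hCφ.le

include hI in
/-- **The limit does not depend on the good sequence.** [cite: Federer1969, 4.2.2] -/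
theorem lim_eq (hvε : ∀ x, v x ≤ ε) (hw : ∀ x, v x ≤ 0 → F.w x = ⊤) {P' : ℝ → Prop}
    (R' : S.GoodSeq hS hv ε P') : F.lim hε R hvε hI = F.lim hε R' hvε hI := by
  ext φ
  set R'' := R.min R'
  have h1 := F.tendsto_seq_sub_of_le hε R hI hw R'' (fun j => min_le_left _ _) φ
  have h2 := F.tendsto_seq_sub_of_le hε R' hI hw R'' (fun j => min_le_right _ _) φ
  have t1 := F.tendsto_seq hε R hI hvε φ
  have t2 := F.tendsto_seq hε R' hI hvε φ
  have t1' : Tendsto (fun j => F.seq hε R'' j φ) atTop (𝓝 (F.lim hε R hvε hI φ)) := by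
    have := h1.add t1; simpa using this
  have t2' : Tendsto (fun j => F.seq hε R'' j φ) atTop (𝓝 (F.lim hε R' hvε hI φ)) := by
    have := h2.add t2; simpa using this
  exact tendsto_nhds_unique t1' t2'

end Current.ShellFamily

end ShellFamily

/-! ## The admissible push-forward — Part B3: `g_{#v} S` as the limit of a shell family; supports -/

section LipSupport

variable {E E' : Type*} [NormedAddCommGroup E] [NormedSpace ℝ E] [FiniteDimensional ℝ E]
  [NormedAddCommGroup E'] [NormedSpace ℝ E'] [FiniteDimensional ℝ E']
  {Ω : Opens E} {Ω' : Opens E'} {m : ℕ}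

/-- **Weak limits do not charge far points**: if `spt T_i ⊆ cthickening δ_i Z` with `δ_i → 0` and
`T_i → T'` weakly, then `spt T' ⊆ Z` (`Z` closed). [folklore] -/
theorem Current.support_subset_of_tendsto_cthickening {T : ℕ → Current Ω' m} {T' : Current Ω' m}
    (h : ∀ φ, Tendsto (fun i => T i φ) atTop (𝓝 (T' φ))) {Z : Set E'} (hZ : IsClosed Z)
    {δ : ℕ → ℝ} (hδ : Tendsto δ atTop (𝓝 0)) (hT : ∀ i, (T i).support ⊆ Metric.cthickening (δ i) Z) :
    T'.support ⊆ Z := by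
  intro y hy
  by_contra hyZ
  obtain ⟨η, hη, hball⟩ : ∃ η > 0, Metric.ball y (η + η) ⊆ Zᶜ := by
    have : Zᶜ ∈ 𝓝 y := hZ.isOpen_compl.mem_nhds hyZ
    obtain ⟨ρ, hρ, hρb⟩ := Metric.mem_nhds_iff.1 this
    exact ⟨ρ / 2, half_pos hρ, by rwa [add_halves]⟩
  obtain ⟨φ, hφ, hne⟩ := hy.2 _ (Metric.isOpen_ball.mem_nhds (Metric.mem_ball_self hη))
  apply hne
  have hev : ∀ᶠ i in atTop, T i φ = 0 := by
    have hδ' : ∀ᶠ i in atTop, δ i < η := hδ (Iio_mem_nhds hη)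
    filter_upwards [hδ'] with i hi
    refine (T i).apply_eq_zero_of_disjoint_support (Set.disjoint_left.2 fun z hz hz' => ?_)
    have hzb : z ∈ Metric.ball y η := hφ hz
    have hzZ : z ∈ Metric.cthickening (δ i) Z := hT i hz'
    rw [Metric.mem_cthickening_iff] at hzZ
    have hlt : Metric.infEDist z Z < ENNReal.ofReal η :=
      lt_of_le_of_lt hzZ (ENNReal.ofReal_lt_ofReal_iff hη |>.2 hi)
    obtain ⟨w, hwZ, hw⟩ := Metric.infEDist_lt_iff.1 hlt
    have hwb : w ∈ Metric.ball y (η + η) := by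
      rw [Metric.mem_ball]
      have h1 : dist z w < η := by
        have := hw
        rwa [edist_dist, ENNReal.ofReal_lt_ofReal_iff hη] at this
      calc dist w y ≤ dist w z + dist z y := dist_triangle _ _ _
        _ < η + η := add_lt_add (by rwa [dist_comm]) (Metric.mem_ball.1 hzb)
    exact hball hwb hwZ
  exact tendsto_nhds_unique (h φ) (tendsto_const_nhds.congr' (by
    filter_upwards [hev] with i hi; exact hi.symm))

namespace Current

variable (T : Current Ω (m + 1)) (hT : T.mass ≠ ⊤) (hdT : T.boundary.mass ≠ ⊤)
  (hsupp : IsCompact T.support)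

include hT hdT in
/-- **Support of the Lipschitz push-forward**: if `f` maps an open neighbourhood `N` of `spt T`
into a closed set `Z`, then `spt f_# T ⊆ Z`. [cite: Federer1969, 4.1.14] -/
theorem support_lipPushforward_subset_of_mapsTo {f : E → E'} {L : ℝ≥0} (hf : LipschitzWith L f)
    {N : Set E} (hN : IsOpen N) (hTN : T.support ⊆ N) {Z : Set E'} (hZ : IsClosed Z)
    (hfZ : Set.MapsTo f N Z) : (T.lipPushforward hT hdT hsupp hf Ω').support ⊆ Z := by
  obtain ⟨χ, U, hU, hTU, hχ1, -, hχN⟩ :=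
    exists_testFunction_eq_one_nhds_subset hsupp hN T.support_subset hTN
  refine Current.support_subset_of_tendsto_cthickening (T.tendsto_lipPushSeq hT hdT hsupp hf) hZ
    (δ := fun i : ℕ => 1 / ((i : ℝ) + 1)) tendsto_one_div_add_atTop_nhds_zero_nat fun i => ?_
  rw [T.lipPushSeq_eq_pushforward hsupp hf hU hTU hχ1 i]
  refine (T.support_pushforward_subset_image χ (contDiff_lipApprox hf i)).trans ?_
  rintro _ ⟨x, hx, rfl⟩
  rw [Metric.mem_cthickening_iff]
  refine (Metric.infEDist_le_edist_of_mem (hfZ (hχN hx))).trans ?_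
  rw [edist_dist]
  exact ENNReal.ofReal_le_ofReal (dist_lipApprox_le hf i x)

end Current

end LipSupport

section AdmissibleB3

open Cubical

variable {V : Type*} [NormedAddCommGroup V] [InnerProductSpace ℝ V] [FiniteDimensional ℝ V]
  [MeasurableSpace V] [BorelSpace V] {n d : ℕ} {v : V → ℝ} {g : V → V} {C : ℝ}
  {S : Current (⊤ : Opens V) (d + 1)}

variable (b : OrthonormalBasis (Fin n) ℝ V) (hS : S.mass ≠ ⊤) (hsupp : IsCompact S.support)
  (hv : Continuous v) (hadm : Admissible v g C) (hC : 0 ≤ C)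

/-- **Support of `P_r`**: if `g` maps `{v > r/2}` into a closed set `Z`, then `spt P_r ⊆ Z`.
[cite: Federer1969, 4.2.2] -/
theorem Current.support_admPush_subset {r : ℝ} (hr : 0 < r)
    (hgood : (S.restrictAbove hS hv r).boundary.mass ≠ ⊤) {Z : Set V} (hZ : IsClosed Z)
    (hgZ : Set.MapsTo g {x | r / 2 < v x} Z) : (S.admPush b hS hsupp hv hadm hC hr hgood).support ⊆ Z := by
  refine Current.support_lipPushforward_subset_of_mapsTo _ _ hgood _ (hadm.lipschitzWith_ext b hC hr)
    (N := {x | r / 2 < v x}) (isOpen_lt continuous_const hv)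
    ((S.support_restrictAbove_subset hS hv r).trans fun x hx => ?_) hZ fun x hx => ?_
  · show r / 2 < v x
    have : r ≤ v x := hx
    linarith
  · have hx' : r / 2 < v x := hx
    rw [hadm.ext_eqOn b hC hr hx'.le]
    exact hgZ hx

/-- **The shell family of the admissible push-forward**: `Ψ_r = P_r = (G_r)_# (S ⌞ {v > r})`,
`K = (8C√n)^{d+1}`, `w = (1/v)^{d+1}`. [cite: Federer1969, 4.2.2] -/
def Current.admFamily : S.ShellFamily hS hv (d + 1) where
  Ψ r hr hgood := S.admPush b hS hsupp hv hadm hC hr hgood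
  K := admConst n C d
  w := admWeight v d
  K_ne_top := ENNReal.pow_ne_top ENNReal.ofReal_ne_top
  measurable_w := measurable_admWeight hv
  shell hr' hr hle h4 hg' hg := by
    rw [S.admPush_sub_admPush b hS hsupp hv hadm hC hr' hr hle hg' hg]
    exact S.mass_admPushShell_le_lintegral b hS hsupp hv hadm hC hr' h4 _
  top hr hv4 hg := S.mass_admPush_le_lintegral b hS hsupp hv hadm hC hr hv4 hg

omit [NormedAddCommGroup V] [InnerProductSpace ℝ V] [FiniteDimensional ℝ V] [MeasurableSpace V] [BorelSpace V] in
/-- The weight is `∞` on `{v ≤ 0}`. [folklore] -/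
theorem admWeight_eq_top {x : V} (hx : v x ≤ 0) : admWeight v d x = ⊤ := by
  unfold admWeight
  rw [ENNReal.ofReal_of_nonpos hx, ENNReal.inv_zero, ENNReal.top_pow (Nat.succ_ne_zero d)]

variable {ε : ℝ} (hε : 0 < ε) {P : ℝ → Prop} (R : S.GoodSeq hS hv ε P) (hvε : ∀ x, v x ≤ ε)
  (hI : ∫⁻ x, admWeight v d x ∂S.variation ≠ ⊤)

/-- **The admissible push-forward `g_{#v} S`** [Federer1969, 4.2.2: "`f_{#u} T = lim_{r→0+} f_#(T ⌞ U_r)`"],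
the limit of the shell family `P_r` along a good sequence (independent of it, `admPushLim_eq`).
[cite: Federer1969, 4.2.2] -/
def Current.admPushLim : Current (⊤ : Opens V) (d + 1) :=
  (S.admFamily b hS hsupp hv hadm hC).lim hε R hvε hI

/-- `P_{r_j}(φ) → (g_{#v} S)(φ)`. [cite: Federer1969, 4.2.2] -/
theorem Current.tendsto_admPush (φ : TestForm (⊤ : Opens V) (d + 1)) :
    Tendsto (fun j => S.admPush b hS hsupp hv hadm hC (R.pos hε j) (R.good j) φ) atTop
      (𝓝 (S.admPushLim b hS hsupp hv hadm hC hε R hvε hI φ)) :=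
  (S.admFamily b hS hsupp hv hadm hC).tendsto_seq hε R hI hvε φ

/-- **`𝐌(g_{#v} S) ≤ (8 C √n)^{d+1} ∫ (1/v)^{d+1} d‖S‖`** [Federer1969, 4.2.2:
"`𝐌(f_{#u} T) ≤ ‖T‖(u^{-m})`"]. [cite: Federer1969, 4.2.2] -/
theorem Current.mass_admPushLim_le :
    (S.admPushLim b hS hsupp hv hadm hC hε R hvε hI).mass ≤ admConst n C d * ∫⁻ x, admWeight v d x ∂S.variation :=
  (S.admFamily b hS hsupp hv hadm hC).mass_lim_le hε R hI hvε

/-- **`g_{#v} S` does not depend on the good sequence.** [cite: Federer1969, 4.2.2] -/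
theorem Current.admPushLim_eq {P' : ℝ → Prop} (R' : S.GoodSeq hS hv ε P') :
    S.admPushLim b hS hsupp hv hadm hC hε R hvε hI = S.admPushLim b hS hsupp hv hadm hC hε R' hvε hI :=
  (S.admFamily b hS hsupp hv hadm hC).lim_eq hε R hI hvε (fun _ hx => admWeight_eq_top hx) R'

/-- **Support of `g_{#v} S`**: if `g` maps `{v > 0}` into a closed set `Z`, then `spt g_{#v} S ⊆ Z`
[Federer1969, 4.2.2: "`spt f_{#u} T ⊂ Clos f(A ∩ spt T)`"]. [cite: Federer1969, 4.2.2] -/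
theorem Current.support_admPushLim_subset {Z : Set V} (hZ : IsClosed Z) (hgZ : Set.MapsTo g {x | 0 < v x} Z) :
    (S.admPushLim b hS hsupp hv hadm hC hε R hvε hI).support ⊆ Z :=
  (S.admFamily b hS hsupp hv hadm hC).support_lim_subset hε R hI hvε hZ fun j =>
    S.support_admPush_subset b hS hsupp hv hadm hC (R.pos hε j) (R.good j) hZ fun _ hx =>
      hgZ (lt_trans (half_pos (R.pos hε j)) hx)

end AdmissibleB3

end Literature.Geometry.GeometricMeasureTheory
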